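import Literature.Geometry.Riemannian.HamiltonODEPositiveCone
import Literature.Geometry.Riemannian.OrthonormalFrameBounds
import HarnessLib

/-!
# Positive curvature operator in Hamilton's block form, and its preservation along the Ricci flow
(topic `Geometry/Riemannian`)

A step of the decomposition of the named fact
`Literature.Geometry.Riemannian.hamilton_positiveCurvatureOperator_classification_four`
(`HamiltonPCOClassification.lean`; Hamilton 1986, Thm. 1.1). The hypothesis of that theorem is
phrased through 2-vectors `φ = Σₐ Xₐ ∧ Yₐ` (`HasPositiveCurvatureOperatorWith`,
`CurvatureOperator.lean`: `Rm(φ, φ) > 0` for `φ ≠ 0`), while Hamilton's proof — and the tree's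
chain of ODE-invariant sets (`HamiltonCurvatureODE.lean`, `HamiltonODEPositiveCone.lean`, …) — works
with the block matrix `M = (A B; ᵗB C)` of the curvature operator in an orthonormal frame
(Hamilton 1986, §6; 1997, §1.2; `CurvatureDecomposition.lean`). This file PROVES the passage
from the first language to the second and draws the consequence for the Ricci flow:

* `quad_blocks_eq_curvatureOperatorForm` — for a Levi-Civita connection, the block quadratic
  form `M(v, v) = ᵗx A x + 2 ᵗx B y + ᵗy C y` (`HamiltonODE.quad`) at `v = (x, y)` **is**
  `Rm(Φ_v, Φ_v)` for the 2-vector `Φ_v = Σ xᵢ φᵢ + Σ yⱼ ψⱼ` (Hamilton's bases `φᵢ`, `ψⱼ` of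
  `Λ²₊`, `Λ²₋` attached to the frame), written as a sum of twelve decomposable 2-vectors; the
  cross terms use the pair symmetry `R(φᵢ, ψⱼ) = R(ψⱼ, φᵢ)` (`bivectorCurvature_symm`);
* `bivectorForm_blockComb_ne_zero` — in an orthonormal frame `Φ_v ≠ 0` for `v ≠ 0`
  (`Φ_v♭(X₁, X_{i+1}) = xᵢ + yᵢ`, `Φ_v♭` on the complementary pair `= xᵢ - yᵢ`);
* `HasPositiveCurvatureOperatorWith.quad_blocks_pos` — hence **positive curvature operator makes
  `M = (A B; ᵗB C)` positive definite in every orthonormal frame**, and, on a compact manifold,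
  uniformly so: `HasPositiveCurvatureOperatorWith.exists_pos_operatorGE_blocks` (`M ≥ m > 0`,
  `HamiltonODE.OperatorGE`, by the compactness lemma `exists_pos_le_curvatureFunctional` of
  `OrthonormalFrameBounds.lean`; Hamilton 1986, §7, p. 170: "Given any compact subset of
  `U = {M > 0}`, we can make the large constants large enough to contain it");
* `ricciFlow_operatorGE_of_hasPositiveCurvatureOperatorWith` — **along a Ricci flow of Riemannian
  metrics on a closed 4-manifold starting with positive curvature operator, the curvature operator
  stays uniformly positive, `M ≥ m > 0`, in every orthonormal frame at every later time**, given
  the maximum principle for systems (the named fact `hamilton_maximumPrinciple_curvatureODE`) —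
  from `ricciFlow_preserves_operatorGE_of_maximumPrinciple` (`HamiltonODEPositiveCone.lean`;
  Hamilton 1986, §7, p. 171: "`M ≥ 0` is preserved").

* `HamiltonODE.OperatorGE.quad_fst`, `….smallestEigenvalueAddNonneg_fst`,
  `….twoSmallestEigenvaluesSumGE_fst`, `….quad_diag`, `….quad_antidiag`,
  `….two_mul_abs_cross_le` (and the `C`-versions) — what `M ≥ m` says about the blocks:
  `A ≥ m`, `C ≥ m` (so `a₁, c₁ ≥ m`, `a₁ + a₂ ≥ 2m` in the variational forms of
  `PinchingEstimatesODE.lean`), `A ± 2B + C ≥ 2m` (Hamilton 1986, p. 169: "by applying `M` to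
  the vectors `(x, x)` and `(x, -x)`"; p. 170), `2|ᵗx B y| ≤ ᵗx A x + ᵗy C y - m(|x|² + |y|²)`.

No named facts and no definitions are introduced (index tables are local to proofs).

## References

* R. S. Hamilton, *Four-manifolds with positive curvature operator*, J. Differential Geom. 24
  (1986) 153–179, §1 (p. 153, the definition), §6 (p. 165, `M = (A B; ᵗB C)`), §7 (pp. 170–171).
  [Hamilton1986]
* R. S. Hamilton, *Four-manifolds with positive isotropic curvature*, Comm. Anal. Geom. 5 (1997)
  1–92, §1.2 (pp. 4–5, the bases `φᵢ`, `ψᵢ` and the blocks). [Hamilton1997]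
-/

noncomputable section

open Bundle Set Function Matrix Finset
open scoped Manifold ContDiff Topology BigOperators

namespace Literature.Geometry.Riemannian

open Lorentzian Lorentzian.PseudoRiemannianMetric HamiltonODE

namespace HamiltonODE

/-! ### Consequences of `M ≥ m` for the blocks (Hamilton 1986, §7, p. 170) -/

section Consequences

variable {p : Blocks} {m : ℝ}

/-- `M ≥ m` restricted to `Λ²₊`: `ᵗx A x ≥ m |x|²` (Hamilton 1986, p. 170: "if `M > 0`, then
`A > 0`"). [cite: Hamilton1986, §7, p. 170] -/
theorem OperatorGE.quad_fst (h : OperatorGE p m) (x : Fin 3 → ℝ) :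
    m * (x ⬝ᵥ x) ≤ x ⬝ᵥ (p.1 *ᵥ x) := by
  have h1 := h (x, 0)
  simp only [quad, normSq, Matrix.mulVec_zero, dotProduct_zero, mul_zero, add_zero] at h1
  exact h1

/-- `M ≥ m` restricted to `Λ²₋`: `ᵗy C y ≥ m |y|²` ("`C > 0`"). [cite: Hamilton1986, §7, p. 170] -/
theorem OperatorGE.quad_snd_snd (h : OperatorGE p m) (y : Fin 3 → ℝ) :
    m * (y ⬝ᵥ y) ≤ y ⬝ᵥ (p.2.2 *ᵥ y) := by
  have h1 := h (0, y)
  simp only [quad, normSq, Matrix.mulVec_zero, dotProduct_zero, mul_zero, add_zero,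
    zero_dotProduct, zero_add] at h1
  exact h1

/-- `M ≥ m` gives `a₁ ≥ m` in the tree's variational form `Matrix.SmallestEigenvalueAddNonneg`
(`a₁ + (-m) ≥ 0`). [cite: Hamilton1986, §7, p. 171] -/
theorem OperatorGE.smallestEigenvalueAddNonneg_fst (h : OperatorGE p m) :
    p.1.SmallestEigenvalueAddNonneg (-m) := by
  intro w hw
  have := h.quad_fst w
  rw [hw, mul_one] at this
  linarith

/-- `M ≥ m` gives `c₁ ≥ m` (`Matrix.SmallestEigenvalueAddNonneg` with `-m`). [cite: Hamilton1986, §7, p. 171] -/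
theorem OperatorGE.smallestEigenvalueAddNonneg_snd_snd (h : OperatorGE p m) :
    p.2.2.SmallestEigenvalueAddNonneg (-m) := by
  intro w hw
  have := h.quad_snd_snd w
  rw [hw, mul_one] at this
  linarith

/-- `M ≥ m` gives `a₁ + a₂ ≥ 2m` (`Matrix.TwoSmallestEigenvaluesSumGE`; for `m > 0` this is the
positive-isotropic-curvature-type condition of Hamilton 1997, Thm. 1.2). [folklore] -/
theorem OperatorGE.twoSmallestEigenvaluesSumGE_fst (h : OperatorGE p m) :
    p.1.TwoSmallestEigenvaluesSumGE (2 * m) := by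
  intro u v hu hv _
  have h1 := h.quad_fst u
  have h2 := h.quad_fst v
  rw [hu, mul_one] at h1
  rw [hv, mul_one] at h2
  linarith

/-- `M ≥ m` gives `c₁ + c₂ ≥ 2m`. [folklore] -/
theorem OperatorGE.twoSmallestEigenvaluesSumGE_snd_snd (h : OperatorGE p m) :
    p.2.2.TwoSmallestEigenvaluesSumGE (2 * m) := by
  intro u v hu hv _
  have h1 := h.quad_snd_snd u
  have h2 := h.quad_snd_snd v
  rw [hu, mul_one] at h1
  rw [hv, mul_one] at h2
  linarith

/-- **`A + 2B + C ≥ 2m`** on the diagonal `(x, x)` (Hamilton 1986, p. 169: "we see that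
`A + 2B + C ≥ 0` and `A - 2B + C ≥ 0`, by applying `M` to the vectors `(x, x)` and `(x, -x)`";
p. 170: "adding the matrices after identifying `Λ²₊` and `Λ²₋` by an isometry").
[cite: Hamilton1986, §6, p. 169; §7, p. 170] -/
theorem OperatorGE.quad_diag (h : OperatorGE p m) (x : Fin 3 → ℝ) :
    2 * m * (x ⬝ᵥ x) ≤ x ⬝ᵥ (p.1 *ᵥ x) + 2 * (x ⬝ᵥ (p.2.1 *ᵥ x)) + x ⬝ᵥ (p.2.2 *ᵥ x) := by
  have h1 := h (x, x)
  simp only [quad, normSq] at h1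
  linarith

/-- **`A - 2B + C ≥ 2m`** on the antidiagonal `(x, -x)`. [cite: Hamilton1986, §6, p. 169; §7, p. 170] -/
theorem OperatorGE.quad_antidiag (h : OperatorGE p m) (x : Fin 3 → ℝ) :
    2 * m * (x ⬝ᵥ x) ≤ x ⬝ᵥ (p.1 *ᵥ x) - 2 * (x ⬝ᵥ (p.2.1 *ᵥ x)) + x ⬝ᵥ (p.2.2 *ᵥ x) := by
  have h1 := h (x, -x)
  simp only [quad, normSq, Matrix.mulVec_neg, dotProduct_neg, neg_dotProduct, neg_neg] at h1
  linarith

/-- **The cross block is dominated by the diagonal blocks**: `2 |ᵗx B y| ≤ ᵗx A x + ᵗy C y - m (|x|² + |y|²)`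
for `M ≥ m` (apply `M ≥ m` to `(x, y)` and `(x, -y)`). [folklore] -/
theorem OperatorGE.two_mul_abs_cross_le (h : OperatorGE p m) (x y : Fin 3 → ℝ) :
    2 * |x ⬝ᵥ (p.2.1 *ᵥ y)| ≤
      x ⬝ᵥ (p.1 *ᵥ x) + y ⬝ᵥ (p.2.2 *ᵥ y) - m * (x ⬝ᵥ x + y ⬝ᵥ y) := by
  have h1 := h (x, y)
  have h2 := h (x, -y)
  simp only [quad, normSq] at h1
  simp only [quad, normSq, Matrix.mulVec_neg, dotProduct_neg, neg_dotProduct, neg_neg] at h2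
  rcases le_or_gt 0 (x ⬝ᵥ (p.2.1 *ᵥ y)) with h0 | h0
  · rw [abs_of_nonneg h0]
    linarith
  · rw [abs_of_neg h0]
    linarith

end Consequences

end HamiltonODE

section Pointwise

variable {E : Type*} [NormedAddCommGroup E] [NormedSpace ℝ E] {H : Type*} [TopologicalSpace H]
  {I : ModelWithCorners ℝ E H} {M : Type*} [TopologicalSpace M] [ChartedSpace H M]
  [IsManifold I ∞ M] {n : ℕ∞ω} [FiniteDimensional ℝ E] [CompleteSpace E]
  {g : PseudoRiemannianMetric I n E (TangentSpace I : M → Type _)}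
  {cov : CovariantDerivative I E (TangentSpace I : M → Type _)}

/-! ### The cross block `B` as a bilinear form in decomposable 2-vectors -/

omit [FiniteDimensional ℝ E] [CompleteSpace E] in
/-- **`ᵗu B w = R(φ_u, ψ_w)`** expanded over the six-plus-six decomposable terms of
`φ_u = Σ uᵢ φᵢ` (`selfDualCombFst/Snd`) and `ψ_w = Σ wⱼ ψⱼ` (`antiSelfDualCombFst/Snd`):
`ᵗu B w = Σ_{a,b} Rm(φ_u⁽ᵃ⁾₁, φ_u⁽ᵃ⁾₂, ψ_w⁽ᵇ⁾₂, ψ_w⁽ᵇ⁾₁)`, the analogue of `blockA_quadratic_eq`.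
[cite: Hamilton1997, §1.2, p. 5] -/
theorem blockB_bilinear_eq (x : M) (e : Fin 4 → TangentSpace I x) (u w : Fin 3 → ℝ) :
    u ⬝ᵥ (g.blockB cov x e *ᵥ w) =
      ∑ a, ∑ b, g.curvatureForm cov x (selfDualCombFst e u a) (selfDualCombSnd e a)
        (antiSelfDualCombSnd e b) (antiSelfDualCombFst e w b) := by
  simp only [blockB, pairingCurvature, bivectorCurvature, curvatureForm, selfDualPairs,
    antiSelfDualPairs, selfDualCombFst, selfDualCombSnd, antiSelfDualCombFst,
    antiSelfDualCombSnd, Matrix.mulVec, dotProduct, Matrix.of_apply, Fin.sum_univ_succ,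
    Fin.sum_univ_zero, Matrix.cons_val_zero, Fin.isValue]
  simp only [map_smul, _root_.smul_apply, smul_eq_mul]
  simp
  ring

/-- **The swapped cross term `R(ψ_w, φ_u)` equals `ᵗu B w`** for a Levi-Civita connection of a
`C^n` metric, `n ≥ 2` (pair symmetry of the curvature pairing, `bivectorCurvature_symm`).
[cite: Hamilton1997, §1.2, p. 5] -/
theorem sum_curvatureForm_antiSelfDual_selfDual (h : g.IsLeviCivita cov) (hn : 2 ≤ n) (x : M)
    (e : Fin 4 → TangentSpace I x) (u w : Fin 3 → ℝ) :
    ∑ a, ∑ b, g.curvatureForm cov x (antiSelfDualCombFst e w a) (antiSelfDualCombSnd e a)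
        (selfDualCombSnd e b) (selfDualCombFst e u b) = u ⬝ᵥ (g.blockB cov x e *ᵥ w) := by
  rw [blockB_bilinear_eq, Finset.sum_comm]
  refine Finset.sum_congr rfl fun b _ ↦ Finset.sum_congr rfl fun a _ ↦ ?_
  have hs := bivectorCurvature_symm h hn x (antiSelfDualCombFst e w a) (antiSelfDualCombSnd e a)
    (selfDualCombFst e u b) (selfDualCombSnd e b)
  simpa only [bivectorCurvature] using hs

/-! ### The 2-vector `Φ_v = Σ xᵢ φᵢ + Σ yⱼ ψⱼ` and `M(v, v) = Rm(Φ_v, Φ_v)` -/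

omit [FiniteDimensional ℝ E] [CompleteSpace E] in
/-- `Rm(φ, φ)` of a concatenation of two lists of decomposable 2-vectors: the two diagonal
blocks and the two cross sums. [folklore] -/
theorem curvatureOperatorForm_append (x : M) {p q : ℕ} (X Y : Fin p → TangentSpace I x)
    (X' Y' : Fin q → TangentSpace I x) :
    g.curvatureOperatorForm cov x (Fin.append X X') (Fin.append Y Y') =
      g.curvatureOperatorForm cov x X Y + g.curvatureOperatorForm cov x X' Y' +
        (∑ a, ∑ b, g.curvatureForm cov x (X a) (Y a) (Y' b) (X' b)) +
        ∑ a, ∑ b, g.curvatureForm cov x (X' a) (Y' a) (Y b) (X b) := by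
  simp only [curvatureOperatorForm, Fin.sum_univ_add, Fin.append_left, Fin.append_right,
    Finset.sum_add_distrib]
  ring

omit [FiniteDimensional ℝ E] [CompleteSpace E] in
/-- The alternating form of a concatenation is the sum. [folklore] -/
theorem bivectorForm_append (x : M) {p q : ℕ} (X Y : Fin p → TangentSpace I x)
    (X' Y' : Fin q → TangentSpace I x) (v w : TangentSpace I x) :
    g.bivectorForm x (Fin.append X X') (Fin.append Y Y') v w =
      g.bivectorForm x X Y v w + g.bivectorForm x X' Y' v w := by
  simp only [bivectorForm, Fin.sum_univ_add, Fin.append_left, Fin.append_right]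

/-- **`M(v, v) = Rm(Φ_v, Φ_v)`**: for a Levi-Civita connection (`C^n` metric, `n ≥ 2`), the block
quadratic form `ᵗx A x + 2 ᵗx B y + ᵗy C y` (`HamiltonODE.quad`) of Hamilton's blocks in the
4-frame `e` at `v = (x, y)` is the curvature-operator form (`curvatureOperatorForm`) of the
2-vector `Φ_v = Σ xᵢ φᵢ + Σ yⱼ ψⱼ`, listed as the twelve decomposable 2-vectors of
`selfDualCombFst/Snd e x` followed by `antiSelfDualCombFst/Snd e y`. (The frame need not be
orthonormal for the identity.) [cite: Hamilton1986, §6, p. 165] [cite: Hamilton1997, §1.2, pp. 4–5] -/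
theorem quad_blocks_eq_curvatureOperatorForm (h : g.IsLeviCivita cov) (hn : 2 ≤ n) (x : M)
    (e : Fin 4 → TangentSpace I x) (v : (Fin 3 → ℝ) × (Fin 3 → ℝ)) :
    quad (g.blockA cov x e, g.blockB cov x e, g.blockC cov x e) v =
      g.curvatureOperatorForm cov x
        (Fin.append (selfDualCombFst e v.1) (antiSelfDualCombFst e v.2))
        (Fin.append (selfDualCombSnd e) (antiSelfDualCombSnd e)) := by
  obtain ⟨u, w⟩ := v
  rw [curvatureOperatorForm_append, ← blockA_quadratic_eq, ← blockC_quadratic_eq,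
    ← blockB_bilinear_eq, sum_curvatureForm_antiSelfDual_selfDual h hn]
  simp only [quad]
  ring

/-! ### `Φ_v ≠ 0` for `v ≠ 0` in an orthonormal frame -/

omit [FiniteDimensional ℝ E] [CompleteSpace E] in
/-- For an orthonormal frame, `φ_u♭` evaluated on the complementary pairs `(X₃, X₄)`, `(X₄, X₂)`,
`(X₂, X₃)` again recovers `u₁, u₂, u₃` (`φ₁ = X₁∧X₂ + X₃∧X₄`, …). [cite: Hamilton1997, §1.2, p. 5] -/
theorem bivectorForm_selfDualComb_compl (x : M) {e : Fin 4 → TangentSpace I x}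
    (he : g.IsOrthonormalFrame x e) (u : Fin 3 → ℝ) (i : Fin 3) :
    g.bivectorForm x (selfDualCombFst e u) (selfDualCombSnd e)
      (e ((![2, 3, 1] : Fin 3 → Fin 4) i)) (e ((![3, 1, 2] : Fin 3 → Fin 4) i)) = u i := by
  obtain ⟨h1, h2⟩ := he
  have h01 := h2 0 1 (by decide); have h02 := h2 0 2 (by decide); have h03 := h2 0 3 (by decide)
  have h12 := h2 1 2 (by decide); have h13 := h2 1 3 (by decide)
  have h21 := h2 2 1 (by decide); have h23 := h2 2 3 (by decide)
  have h31 := h2 3 1 (by decide); have h32 := h2 3 2 (by decide)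
  fin_cases i <;>
    simp [bivectorForm, selfDualCombFst, selfDualCombSnd, Fin.sum_univ_succ, map_smul,
      _root_.smul_apply, smul_eq_mul, h1 1, h1 2, h1 3, h01, h02, h03, h12, h13, h21, h23, h31,
      h32]

omit [FiniteDimensional ℝ E] [CompleteSpace E] in
/-- For an orthonormal frame, `ψ_u♭` on the complementary pairs gives `-u₁, -u₂, -u₃`
(`ψ₁ = X₁∧X₂ - X₃∧X₄`, …). [cite: Hamilton1997, §1.2, p. 5] -/
theorem bivectorForm_antiSelfDualComb_compl (x : M) {e : Fin 4 → TangentSpace I x}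
    (he : g.IsOrthonormalFrame x e) (u : Fin 3 → ℝ) (i : Fin 3) :
    g.bivectorForm x (antiSelfDualCombFst e u) (antiSelfDualCombSnd e)
      (e ((![2, 3, 1] : Fin 3 → Fin 4) i)) (e ((![3, 1, 2] : Fin 3 → Fin 4) i)) = -u i := by
  obtain ⟨h1, h2⟩ := he
  have h01 := h2 0 1 (by decide); have h02 := h2 0 2 (by decide); have h03 := h2 0 3 (by decide)
  have h12 := h2 1 2 (by decide); have h13 := h2 1 3 (by decide)
  have h21 := h2 2 1 (by decide); have h23 := h2 2 3 (by decide)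
  have h31 := h2 3 1 (by decide); have h32 := h2 3 2 (by decide)
  fin_cases i <;>
    simp [bivectorForm, antiSelfDualCombFst, antiSelfDualCombSnd, Fin.sum_univ_succ, map_smul,
      _root_.smul_apply, smul_eq_mul, h1 1, h1 2, h1 3, h01, h02, h03, h12, h13, h21, h23, h31,
      h32]

omit [FiniteDimensional ℝ E] [CompleteSpace E] in
/-- **In an orthonormal frame `Φ_v ≠ 0` for `v = (x, y) ≠ 0`**: `Φ_v♭(X₁, X_{i+1}) = xᵢ + yᵢ` and
`Φ_v♭` on the complementary pair is `xᵢ - yᵢ`. [cite: Hamilton1997, §1.2, p. 5] -/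
theorem bivectorForm_blockComb_ne_zero (x : M) {e : Fin 4 → TangentSpace I x}
    (he : g.IsOrthonormalFrame x e) {v : (Fin 3 → ℝ) × (Fin 3 → ℝ)} (hv : v ≠ 0) :
    ∃ a b : TangentSpace I x,
      g.bivectorForm x (Fin.append (selfDualCombFst e v.1) (antiSelfDualCombFst e v.2))
        (Fin.append (selfDualCombSnd e) (antiSelfDualCombSnd e)) a b ≠ 0 := by
  obtain ⟨u, w⟩ := v
  by_contra hcon
  push Not at hcon
  apply hv
  have hsum : ∀ i, u i + w i = 0 := fun i ↦ by
    have h0 := hcon (e 0) (e i.succ)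
    rwa [bivectorForm_append, bivectorForm_selfDualComb x he, bivectorForm_antiSelfDualComb x he]
      at h0
  have hdiff : ∀ i, u i - w i = 0 := fun i ↦ by
    have h0 := hcon (e ((![2, 3, 1] : Fin 3 → Fin 4) i)) (e ((![3, 1, 2] : Fin 3 → Fin 4) i))
    rw [bivectorForm_append, bivectorForm_selfDualComb_compl x he,
      bivectorForm_antiSelfDualComb_compl x he] at h0
    linarith
  have hu : u = 0 := funext fun i ↦ by have := hsum i; have := hdiff i; simp only [Pi.zero_apply]; linarith
  have hw : w = 0 := funext fun i ↦ by have := hsum i; have := hdiff i; simp only [Pi.zero_apply]; linarith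
  rw [hu, hw]
  rfl

/-! ### Positive curvature operator in block form -/

/-- **Positive curvature operator makes `M = (A B; ᵗB C)` positive definite**: for a Levi-Civita
connection with positive curvature operator (`HasPositiveCurvatureOperatorWith`: `Rm(φ, φ) > 0`
for `φ ≠ 0`; Hamilton 1986, p. 153), in every orthonormal 4-frame the block quadratic form is
positive, `ᵗx A x + 2 ᵗx B y + ᵗy C y > 0` for `(x, y) ≠ 0` — Hamilton's `M > 0` (1986, §7).
[cite: Hamilton1986, §1, p. 153; §7, p. 170] -/
theorem _root_.Literature.Geometry.Lorentzian.PseudoRiemannianMetric.HasPositiveCurvatureOperatorWith.quad_blocks_pos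
    (hR : g.HasPositiveCurvatureOperatorWith cov) (h : g.IsLeviCivita cov) (hn : 2 ≤ n) (x : M)
    {e : Fin 4 → TangentSpace I x} (he : g.IsOrthonormalFrame x e)
    {v : (Fin 3 → ℝ) × (Fin 3 → ℝ)} (hv : v ≠ 0) :
    0 < quad (g.blockA cov x e, g.blockB cov x e, g.blockC cov x e) v := by
  rw [quad_blocks_eq_curvatureOperatorForm h hn]
  exact hR x _ _ _ (bivectorForm_blockComb_ne_zero x he hv)

/-- In particular `M ≥ 0` (`HamiltonODE.OperatorGE · 0`) in every orthonormal frame.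
[cite: Hamilton1986, §7, p. 171] -/
theorem _root_.Literature.Geometry.Lorentzian.PseudoRiemannianMetric.HasPositiveCurvatureOperatorWith.operatorGE_zero_blocks
    (hR : g.HasPositiveCurvatureOperatorWith cov) (h : g.IsLeviCivita cov) (hn : 2 ≤ n) (x : M)
    {e : Fin 4 → TangentSpace I x} (he : g.IsOrthonormalFrame x e) :
    OperatorGE (g.blockA cov x e, g.blockB cov x e, g.blockC cov x e) 0 := by
  intro v
  rw [zero_mul]
  by_cases hv : v = 0
  · subst hv
    rw [quad_zero_right]
  · exact (hR.quad_blocks_pos h hn x he hv).le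

end Pointwise

/-! ### Compactness: a uniform `M ≥ m > 0` -/

section Compactness

variable {E : Type*} [NormedAddCommGroup E] [NormedSpace ℝ E] {H : Type*} [TopologicalSpace H]
  {I : ModelWithCorners ℝ E H} {M : Type*} [TopologicalSpace M] [ChartedSpace H M]
  [IsManifold I ∞ M] [FiniteDimensional ℝ E] [CompleteSpace E] [T2Space M] [CompactSpace M]
  [LocallyCompactSpace M]
  {g : PseudoRiemannianMetric I ∞ E (TangentSpace I : M → Type _)}
  {cov : CovariantDerivative I E (TangentSpace I : M → Type _)}

/-- **Uniform positivity `M ≥ m > 0` on a compact manifold with positive curvature operator**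
(Hamilton 1986, §7, p. 170: "Given any compact subset of `U = {M > 0}`, we can make the large
constants large enough to contain it"): for a Riemannian `C^∞` metric with Levi-Civita connection
and positive curvature operator on a compact manifold there is `m > 0` with `M ≥ m`
(`HamiltonODE.OperatorGE`) for the blocks of every orthonormal 4-frame at every point. The blocks
are continuous functions of the curvature components of the frame and `M(v, v) > 0` on the unit
sphere (`quad_blocks_pos`), so `exists_pos_le_curvatureFunctional` (`OrthonormalFrameBounds.lean`)
applies. [cite: Hamilton1986, §7, p. 170] -/
theorem _root_.Literature.Geometry.Lorentzian.PseudoRiemannianMetric.HasPositiveCurvatureOperatorWith.exists_pos_operatorGE_blocks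
    (hg : g.IsRiemannian) (hcov : g.IsLeviCivita cov) (hR : g.HasPositiveCurvatureOperatorWith cov) :
    ∃ m : ℝ, 0 < m ∧ ∀ (x : M) (e : Fin 4 → TangentSpace I x), g.IsOrthonormalFrame x e →
      OperatorGE (g.blockA cov x e, g.blockB cov x e, g.blockC cov x e) m := by
  have hn : (2 : ℕ∞ω) ≤ ∞ := WithTop.coe_le_coe.mpr le_top
  -- index tables of Hamilton's bases: `selfDualPairs e i a = (e (σ₁ i a), e (σ₂ i a))`,
  -- `antiSelfDualPairs e i a = (e (τ₁ i a), e (τ₂ i a))`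
  set σ₁ : Fin 3 → Fin 2 → Fin 4 := ![![0, 2], ![0, 3], ![0, 1]] with hσ₁
  set σ₂ : Fin 3 → Fin 2 → Fin 4 := ![![1, 3], ![2, 1], ![3, 2]] with hσ₂
  set τ₁ : Fin 3 → Fin 2 → Fin 4 := ![![0, 3], ![0, 1], ![0, 2]] with hτ₁
  set τ₂ : Fin 3 → Fin 2 → Fin 4 := ![![1, 2], ![2, 3], ![3, 1]] with hτ₂
  -- the blocks as functions of the curvature components `R a b c d = Rm(e_a, e_b, e_c, e_d)`
  set MA : (Fin 4 → Fin 4 → Fin 4 → Fin 4 → ℝ) → Matrix (Fin 3) (Fin 3) ℝ := fun R ↦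
    Matrix.of fun i j ↦ ∑ a, ∑ b, R (σ₁ i a) (σ₂ i a) (σ₂ j b) (σ₁ j b) with hMA
  set MB : (Fin 4 → Fin 4 → Fin 4 → Fin 4 → ℝ) → Matrix (Fin 3) (Fin 3) ℝ := fun R ↦
    Matrix.of fun i j ↦ ∑ a, ∑ b, R (σ₁ i a) (σ₂ i a) (τ₂ j b) (τ₁ j b) with hMB
  set MC : (Fin 4 → Fin 4 → Fin 4 → Fin 4 → ℝ) → Matrix (Fin 3) (Fin 3) ℝ := fun R ↦
    Matrix.of fun i j ↦ ∑ a, ∑ b, R (τ₁ i a) (τ₂ i a) (τ₂ j b) (τ₁ j b) with hMC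
  have hA : ∀ (x : M) (e : Fin 4 → TangentSpace I x),
      MA (fun a b c d ↦ g.curvatureForm cov x (e a) (e b) (e c) (e d)) = g.blockA cov x e := by
    intro x e
    ext i j
    fin_cases i <;> fin_cases j <;>
      simp [hMA, hσ₁, hσ₂, blockA, pairingCurvature, bivectorCurvature, selfDualPairs,
        Fin.sum_univ_two]
  have hB : ∀ (x : M) (e : Fin 4 → TangentSpace I x),
      MB (fun a b c d ↦ g.curvatureForm cov x (e a) (e b) (e c) (e d)) = g.blockB cov x e := by
    intro x e
    ext i j
    fin_cases i <;> fin_cases j <;>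
      simp [hMB, hσ₁, hσ₂, hτ₁, hτ₂, blockB, pairingCurvature, bivectorCurvature, selfDualPairs,
        antiSelfDualPairs, Fin.sum_univ_two]
  have hC : ∀ (x : M) (e : Fin 4 → TangentSpace I x),
      MC (fun a b c d ↦ g.curvatureForm cov x (e a) (e b) (e c) (e d)) = g.blockC cov x e := by
    intro x e
    ext i j
    fin_cases i <;> fin_cases j <;>
      simp [hMC, hτ₁, hτ₂, blockC, pairingCurvature, bivectorCurvature, antiSelfDualPairs,
        Fin.sum_univ_two]
  -- the functional `M(v, v)`
  set F : (Fin 4 → Fin 4 → Fin 4 → Fin 4 → ℝ) → (Fin 3 → ℝ) × (Fin 3 → ℝ) → ℝ := fun R y ↦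
    quad (MA R, MB R, MC R) y with hF
  have hRcont : ∀ a b c d : Fin 4,
      Continuous fun R : Fin 4 → Fin 4 → Fin 4 → Fin 4 → ℝ ↦ R a b c d := fun a b c d ↦
    (continuous_apply d).comp ((continuous_apply c).comp
      ((continuous_apply b).comp (continuous_apply a)))
  have hMcont : ∀ {ρ₁ ρ₂ ρ₃ ρ₄ : Fin 3 → Fin 2 → Fin 4},
      Continuous fun R : Fin 4 → Fin 4 → Fin 4 → Fin 4 → ℝ ↦
        (Matrix.of fun i j ↦ ∑ a, ∑ b, R (ρ₁ i a) (ρ₂ i a) (ρ₃ j b) (ρ₄ j b) :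
          Matrix (Fin 3) (Fin 3) ℝ) := by
    intro ρ₁ ρ₂ ρ₃ ρ₄
    refine continuous_matrix fun i j ↦ ?_
    simp only [Matrix.of_apply]
    exact continuous_finsetSum _ fun a _ ↦ continuous_finsetSum _ fun b _ ↦ hRcont _ _ _ _
  have hblocks : Continuous fun R : Fin 4 → Fin 4 → Fin 4 → Fin 4 → ℝ ↦
      ((MA R, MB R, MC R) : Blocks) := (hMcont.prodMk (hMcont.prodMk hMcont))
  have hFcont : Continuous (uncurry F) := by
    have h1 : Continuous fun p : (Fin 4 → Fin 4 → Fin 4 → Fin 4 → ℝ) × ((Fin 3 → ℝ) × (Fin 3 → ℝ)) ↦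
        (((MA p.1, MB p.1, MC p.1) : Blocks), p.2) :=
      (hblocks.comp continuous_fst).prodMk continuous_snd
    exact continuous_quad.comp h1
  -- positivity on the unit sphere of `Λ²`
  have hpos : ∀ (x : M) (e : Fin 4 → TangentSpace I x), g.IsOrthonormalFrame x e →
      ∀ y ∈ sphere6, 0 < F (fun a b c d ↦ g.curvatureForm cov x (e a) (e b) (e c) (e d)) y := by
    intro x e he y hy
    simp only [hF, hA x e, hB x e, hC x e]
    refine hR.quad_blocks_pos hcov hn x he fun hy0 ↦ ?_
    have : HamiltonODE.normSq y = 1 := hy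
    rw [hy0] at this
    simp [HamiltonODE.normSq] at this
  obtain ⟨m, hm, hmle⟩ :=
    exists_pos_le_curvatureFunctional hg hcov isCompact_sphere6 hFcont.continuousOn hpos
  refine ⟨m, hm, fun x e he ↦ operatorGE_of_sphere6 fun y hy ↦ ?_⟩
  have := hmle x e he y hy
  simp only [hF, hA x e, hB x e, hC x e] at this
  exact this

end Compactness

/-! ### Positive curvature operator stays uniformly positive along the Ricci flow -/

universe u

/-- **Hamilton 1986: positive curvature operator is preserved by the Ricci flow on a closed
4-manifold — in fact `M ≥ m > 0` uniformly in `t` — given the maximum principle for systems.**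
Along a Ricci flow `(g, cov)` of Riemannian metrics on `[0, T)` on a closed smooth 4-manifold
whose initial pair `(g 0, cov 0)` (a Levi-Civita connection, `IsRicciFlow.isLeviCivita`) has
positive curvature operator (`HasPositiveCurvatureOperatorWith`), there is `m > 0` such that for
every `t ∈ [0, T)` the blocks `(A, B, C)` of `(g t, cov t)` satisfy `M ≥ m` in every
`g t`-orthonormal frame. Proof: `exists_pos_operatorGE_blocks` at `t = 0` and
`ricciFlow_preserves_operatorGE_of_maximumPrinciple` (Hamilton 1986, §7, p. 171: "`M ≥ 0` is
preserved"; §5, 5.2; §4, Thm. 4.3 = the named fact `hamilton_maximumPrinciple_curvatureODE`).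
[cite: Hamilton1986, §7, pp. 170–171; §5, 5.2 (p. 164); §4, Thm. 4.3 (p. 162)] -/
theorem ricciFlow_operatorGE_of_hasPositiveCurvatureOperatorWith
    (hMP : hamilton_maximumPrinciple_curvatureODE.{u})
    (M : Type u) [TopologicalSpace M] [T2Space M] [SecondCountableTopology M] [CompactSpace M]
    [ChartedSpace (EuclideanSpace ℝ (Fin 4)) M] [IsManifold (𝓡 4) ∞ M] (T : ℝ)
    (g : ℝ → PseudoRiemannianMetric (𝓡 4) ∞ (EuclideanSpace ℝ (Fin 4))
      (TangentSpace (𝓡 4) : M → Type _))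
    (cov : ℝ → CovariantDerivative (𝓡 4) (EuclideanSpace ℝ (Fin 4))
      (TangentSpace (𝓡 4) : M → Type _))
    (hflow : IsRicciFlow g cov (Ico 0 T)) (hRiem : ∀ t ∈ Ico 0 T, (g t).IsRiemannian)
    (hR : (g 0).HasPositiveCurvatureOperatorWith (cov 0)) :
    ∃ m : ℝ, 0 < m ∧ ∀ t ∈ Ico 0 T, ∀ (x : M) (e : Fin 4 → TangentSpace (𝓡 4) x),
      (g t).IsOrthonormalFrame x e →
        OperatorGE ((g t).blockA (cov t) x e, (g t).blockB (cov t) x e, (g t).blockC (cov t) x e)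
          m := by
  by_cases hT : 0 < T
  · haveI : LocallyCompactSpace M := ChartedSpace.locallyCompactSpace (EuclideanSpace ℝ (Fin 4)) M
    have hLC : (g 0).IsLeviCivita (cov 0) := hflow.isLeviCivita 0 ⟨le_rfl, hT⟩
    obtain ⟨m, hm, h0⟩ := hR.exists_pos_operatorGE_blocks (hRiem 0 ⟨le_rfl, hT⟩) hLC
    exact ⟨m, hm, ricciFlow_preserves_operatorGE_of_maximumPrinciple hMP M T g cov hflow hRiem
      hm.le h0⟩
  · exact ⟨1, one_pos, fun t ht ↦ absurd (ht.1.trans_lt ht.2) hT⟩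

end Literature.Geometry.Riemannian

end
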